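import Mathlib
import Literature.Analysis.PDE.NearInverseSquareFarPowerAdapter
import Literature.Analysis.PDE.NearInverseSquareFarKernelElements
import Literature.Analysis.PDE.NearInverseSquareFarKernelCloseness
import Literature.Analysis.PDE.NearInverseSquareFarKernelZero

/-!
# The true kernel family of the far channel estimate at unit scale

Analysis/PDE support file (everything proved). For every `n` and the smooth `ι = 1/x` on `[½,∞)`
there is `ε_K(n, ι) > 0` such that every continuous `W ≥ 0` with `|W − n(n+1)/x²| ≤ ε_K x^{-5/2}`
on `[½,∞)` carries a finite family of true kernel elements (global `C²`, solving on `{x ≥ 1}`,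
finite energy, non-radiating, `t`-polynomial on the cone) satisfying `happroxK`: hypothesis `hK` of
`NearInverseSquareFarUnit.unitFarChannel_of_kernelFamily` (`trueKernelFamily`). Assembly of
`NearInverseSquareFarKernelElements` (elements, `n ≥ 1`), `NearInverseSquareFarKernelZero`
(`n = 0`), `NearInverseSquareFarKernelCloseness` (relative closeness) and
`NearInverseSquareFarPowerAdapter.kernelFamily_of_powerFamily`. Route PhotonSphereChannels,
`FixedModeChannels`, far side (stmt-FinalStateConjecture-10048). Folklore.
-/

noncomputable section

namespace Literature.Analysis.PDE

open Set Filter MeasureTheory Finset Literature.Analysis.ODE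
open scoped Topology

variable {ι : ℝ → ℝ}

/-- The zero function is a (trivial) kernel element. [folklore] -/
theorem zero_kernelElement (W : ℝ → ℝ) :
    ContDiff ℝ 2 (Function.uncurry (fun _ _ : ℝ => (0 : ℝ))) ∧
    (∀ t x : ℝ, 1 ≤ x → iteratedDeriv 2 (fun τ : ℝ => (fun _ _ : ℝ => (0 : ℝ)) τ x) t
      - iteratedDeriv 2 ((fun _ _ : ℝ => (0 : ℝ)) t) x + W x * (fun _ _ : ℝ => (0 : ℝ)) t x = 0) ∧
    IntegrableOn (fun x => deriv (fun τ => (fun _ _ : ℝ => (0 : ℝ)) τ x) 0 ^ 2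
      + deriv ((fun _ _ : ℝ => (0 : ℝ)) 0) x ^ 2 + W x * (fun _ _ : ℝ => (0 : ℝ)) 0 x ^ 2) (Ioi 1) ∧
    Tendsto (fun t => ∫ x in Ioi (1 + |t|), (deriv (fun τ => (fun _ _ : ℝ => (0 : ℝ)) τ x) t ^ 2
      + deriv ((fun _ _ : ℝ => (0 : ℝ)) t) x ^ 2 + W x * (fun _ _ : ℝ => (0 : ℝ)) t x ^ 2)) atTop (𝓝 0) ∧
    Tendsto (fun t => ∫ x in Ioi (1 + |t|), (deriv (fun τ => (fun _ _ : ℝ => (0 : ℝ)) τ x) t ^ 2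
      + deriv ((fun _ _ : ℝ => (0 : ℝ)) t) x ^ 2 + W x * (fun _ _ : ℝ => (0 : ℝ)) t x ^ 2)) atBot (𝓝 0) ∧
    (∃ (N : ℕ) (α : ℕ → ℝ → ℝ), ∀ z : ℝ × ℝ, 1 + |z.1| < z.2 →
      (fun _ _ : ℝ => (0 : ℝ)) z.1 z.2 = ∑ i ∈ Finset.range N, α i z.2 * z.1 ^ i) := by
  have h2 : ∀ x : ℝ, iteratedDeriv 2 (fun _ : ℝ => (0 : ℝ)) x = 0 := fun x => by
    rw [iteratedDeriv_const]; simp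
  refine ⟨contDiff_const, fun t x _ => by simp only [h2, mul_zero, sub_zero, add_zero], ?_, ?_, ?_,
    ⟨0, fun _ _ => 0, fun z _ => by simp⟩⟩
  · simp only [deriv_const', mul_zero, add_zero, ne_eq, OfNat.ofNat_ne_zero, not_false_eq_true,
      zero_pow]
    exact integrableOn_zero
  · simp only [deriv_const', mul_zero, add_zero, ne_eq, OfNat.ofNat_ne_zero, not_false_eq_true,
      zero_pow, integral_zero]
    exact tendsto_const_nhds
  · simp only [deriv_const', mul_zero, add_zero, ne_eq, OfNat.ofNat_ne_zero, not_false_eq_true,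
      zero_pow, integral_zero]
    exact tendsto_const_nhds

/-- **The true kernel family (hypothesis `hK` of `unitFarChannel_of_kernelFamily`).** See the
module docstring. [folklore] -/
theorem trueKernelFamily (hι : ContDiff ℝ (⊤ : ℕ∞) ι) (hιeq : ∀ x : ℝ, 1 / 2 ≤ x → ι x = x⁻¹)
    (n : ℕ) :
    ∃ εK : ℝ, 0 < εK ∧ ∀ (W : ℝ → ℝ), Continuous W → (∀ x, 0 ≤ W x) →
      (∀ x : ℝ, 1 / 2 ≤ x → |W x - (n : ℝ) * ((n : ℝ) + 1) / x ^ 2| ≤ εK * x ^ (-(5 : ℝ) / 2)) →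
      ∃ (M : ℕ) (B : Fin M → ℝ → ℝ → ℝ), (∀ m, ContDiff ℝ 2 (Function.uncurry (B m))) ∧
      (∀ m t x, 1 ≤ x →
        iteratedDeriv 2 (fun τ => B m τ x) t - iteratedDeriv 2 (B m t) x + W x * B m t x = 0) ∧
      (∀ m, IntegrableOn (fun x => deriv (fun τ => B m τ x) 0 ^ 2 + deriv (B m 0) x ^ 2
        + W x * B m 0 x ^ 2) (Ioi 1)) ∧
      (∀ m, Tendsto (fun t => ∫ x in Ioi (1 + |t|), (deriv (fun τ => B m τ x) t ^ 2
        + deriv (B m t) x ^ 2 + W x * B m t x ^ 2)) atTop (𝓝 0)) ∧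
      (∀ m, Tendsto (fun t => ∫ x in Ioi (1 + |t|), (deriv (fun τ => B m τ x) t ^ 2
        + deriv (B m t) x ^ 2 + W x * B m t x ^ 2)) atBot (𝓝 0)) ∧
      (∀ m, ∃ (N : ℕ) (a : ℕ → ℝ → ℝ), ∀ z : ℝ × ℝ, 1 + |z.1| < z.2 →
        B m z.1 z.2 = ∑ i ∈ Finset.range N, a i z.2 * z.1 ^ i) ∧
      (∀ (ch cg : ℕ → ℝ) (ε' : ℝ), 0 < ε' → ∃ c : Fin M → ℝ,
        Real.sqrt (∫ x in Ioi 1,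
          (deriv (fun y => ladder ι n (fun z => ∑ m ∈ Finset.range (n + 1),
              ch m / m.factorial * (z - 1) ^ m) y - ∑ m, c m * B m 0 y) x ^ 2
          + W x * (ladder ι n (fun z => ∑ m ∈ Finset.range (n + 1),
              ch m / m.factorial * (z - 1) ^ m) x - ∑ m, c m * B m 0 x) ^ 2
          + (ladder ι n (fun z => ∑ m ∈ Finset.range n, cg m / m.factorial * (z - 1) ^ m) x
              - ∑ m, c m * deriv (fun τ => B m τ x) 0) ^ 2))
        ≤ (1 / 2) * Real.sqrt (∫ x in Ioi 1,
          (deriv (ladder ι n (fun z => ∑ m ∈ Finset.range (n + 1),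
              ch m / m.factorial * (z - 1) ^ m)) x ^ 2
          + W x * (ladder ι n (fun z => ∑ m ∈ Finset.range (n + 1),
              ch m / m.factorial * (z - 1) ^ m) x) ^ 2
          + (ladder ι n (fun z => ∑ m ∈ Finset.range n, cg m / m.factorial * (z - 1) ^ m) x) ^ 2))
          + ε') := by
  classical
  obtain ⟨δ₀, hδ₀, hKFP⟩ := kernelFamily_of_powerFamily hι hιeq n
  rcases Nat.eq_zero_or_pos n with hn0 | hn1
  · -- `n = 0`: one static element, relative closeness
    subst hn0
    obtain ⟨εK, hεK, hεK4, hK4⟩ := exists_farKernelElement_zero (ι := ι) hδ₀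
    refine ⟨εK, hεK, fun W hW hW0 hclose => ?_⟩
    obtain ⟨B, hB, hres, hint, hT, hBo, hpoly, hcl⟩ := hK4 hW hW0 hclose
    obtain ⟨z1, z2, z3, z4, z5, z6⟩ := zero_kernelElement W
    exact hKFP W hW hW0 εK hεK.le hεK4 hclose (fun _ => B) (fun _ _ _ => 0) (fun _ => hB)
      (fun _ => z1) (fun _ => hres) (fun _ => z2) (fun _ => hint) (fun _ => z3) (fun _ => hT)
      (fun _ => hBo) (fun _ => z4) (fun _ => z5) (fun _ => hpoly) (fun _ => z6)
      (fun k hk => by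
        have hk0 : k = 0 := by simp only [Finset.mem_range] at hk; omega
        subst hk0
        exact hcl)
      (fun k hk => by simp only [Finset.mem_range] at hk; omega)
  · -- `n ≥ 1`
    have hel : ∀ k π : ℕ, π ≤ 1 → ∃ K : ℝ, 0 ≤ K ∧ ∀ {W : ℝ → ℝ} {ε : ℝ}, Continuous W →
        (∀ x, 0 ≤ W x) → 0 ≤ ε → ε ≤ 1 / (64 * ((n : ℝ) + 1)) →
        (∀ x : ℝ, 1 / 2 ≤ x → |W x - (n : ℝ) * ((n : ℝ) + 1) / x ^ 2| ≤ ε * x ^ (-(5 : ℝ) / 2)) →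
        2 * k + π ≤ n →
        ∃ (B : ℝ → ℝ → ℝ) (f f' : ℝ → ℝ), ContDiff ℝ 2 (Function.uncurry B) ∧
          (∀ t x, 1 ≤ x →
            iteratedDeriv 2 (fun τ => B τ x) t - iteratedDeriv 2 (B t) x + W x * B t x = 0) ∧
          IntegrableOn (fun x => deriv (fun τ => B τ x) 0 ^ 2 + deriv (B 0) x ^ 2
            + W x * B 0 x ^ 2) (Ioi 1) ∧
          Tendsto (fun t => ∫ x in Ioi (1 + |t|), (deriv (fun τ => B τ x) t ^ 2
            + deriv (B t) x ^ 2 + W x * B t x ^ 2)) atTop (𝓝 0) ∧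
          Tendsto (fun t => ∫ x in Ioi (1 + |t|), (deriv (fun τ => B τ x) t ^ 2
            + deriv (B t) x ^ 2 + W x * B t x ^ 2)) atBot (𝓝 0) ∧
          (∃ (N : ℕ) (α : ℕ → ℝ → ℝ), ∀ z : ℝ × ℝ, 1 + |z.1| < z.2 →
            B z.1 z.2 = ∑ i ∈ Finset.range N, α i z.2 * z.1 ^ i) ∧
          (∀ x, 1 ≤ x → B 0 x = (1 - (π : ℝ)) * f x ∧ deriv (fun τ => B τ x) 0 = (π : ℝ) * f x ∧
            deriv (B 0) x = (1 - (π : ℝ)) * f' x) ∧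
          (∀ x, (1 / 2 : ℝ) < x → HasDerivAt f (f' x) x) ∧ Continuous f ∧
          (∀ x : ℝ, 1 / 2 ≤ x →
            |f x - x ^ ((2 * k : ℝ) - n)| ≤ K * ε * x ^ ((2 * k : ℝ) - n - 1 / 2) ∧
            |f' x - ((2 * k : ℝ) - n) * x ^ ((2 * k : ℝ) - n - 1)|
              ≤ K * ε * x ^ ((2 * k : ℝ) - n - 3 / 2)) := by
      intro k π hπ
      by_cases h : 2 * k + π ≤ n
      · obtain ⟨K, hK0, hK⟩ := exists_farKernelElement n k π hπ h
        exact ⟨K, hK0, fun hW hW0 hε0 hε hcl _ => hK hW hW0 hε0 hε hcl⟩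
      · exact ⟨0, le_rfl, fun _ _ _ _ _ h' => absurd h' h⟩
    choose Kp hKp0 hKp using fun k => hel k 0 (Nat.zero_le 1)
    choose Kv hKv0 hKv using fun k => hel k 1 le_rfl
    set Kmax : ℝ := ∑ k ∈ range (n + 1), (Kp k + Kv k) with hKmax
    have hKmax0 : 0 ≤ Kmax := Finset.sum_nonneg fun k _ => add_nonneg (hKp0 k) (hKv0 k)
    have hKpK : ∀ k, k ≤ n → Kp k ≤ Kmax := fun k hk => by
      rw [hKmax]
      refine le_trans (le_add_of_nonneg_right (hKv0 k)) ?_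
      exact Finset.single_le_sum (f := fun k => Kp k + Kv k)
        (fun i _ => add_nonneg (hKp0 i) (hKv0 i)) (Finset.mem_range.2 (by omega))
    have hKvK : ∀ k, k ≤ n → Kv k ≤ Kmax := fun k hk => by
      rw [hKmax]
      refine le_trans (le_add_of_nonneg_left (hKp0 k)) ?_
      exact Finset.single_le_sum (f := fun k => Kp k + Kv k)
        (fun i _ => add_nonneg (hKp0 i) (hKv0 i)) (Finset.mem_range.2 (by omega))
    have hn0 : (0 : ℝ) ≤ n := n.cast_nonneg
    set εK : ℝ := min (1 / (64 * ((n : ℝ) + 1))) (min (1 / 4) (δ₀ / (2 * ((n : ℝ) + 2) * (Kmax + 1))))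
      with hεK
    have hεK0 : 0 < εK := lt_min (by positivity) (lt_min (by norm_num) (by positivity))
    have hεK64 : εK ≤ 1 / (64 * ((n : ℝ) + 1)) := min_le_left _ _
    have hεK4 : εK ≤ 1 / 4 := (min_le_right _ _).trans (min_le_left _ _)
    have hεKδ : εK ≤ δ₀ / (2 * ((n : ℝ) + 2) * (Kmax + 1)) := (min_le_right _ _).trans (min_le_right _ _)
    have hεKδ' : εK * (2 * ((n : ℝ) + 2) * (Kmax + 1)) ≤ δ₀ := by
      rwa [← le_div_iff₀ (by positivity)]
    refine ⟨εK, hεK0, fun W hW hW0 hclose => ?_⟩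
    obtain ⟨z1, z2, z3, z4, z5, z6⟩ := zero_kernelElement W
    -- position elements
    have hPk : ∀ k : ℕ, ∃ B : ℝ → ℝ → ℝ, ContDiff ℝ 2 (Function.uncurry B) ∧
        (∀ t x, 1 ≤ x →
          iteratedDeriv 2 (fun τ => B τ x) t - iteratedDeriv 2 (B t) x + W x * B t x = 0) ∧
        IntegrableOn (fun x => deriv (fun τ => B τ x) 0 ^ 2 + deriv (B 0) x ^ 2
          + W x * B 0 x ^ 2) (Ioi 1) ∧
        Tendsto (fun t => ∫ x in Ioi (1 + |t|), (deriv (fun τ => B τ x) t ^ 2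
          + deriv (B t) x ^ 2 + W x * B t x ^ 2)) atTop (𝓝 0) ∧
        Tendsto (fun t => ∫ x in Ioi (1 + |t|), (deriv (fun τ => B τ x) t ^ 2
          + deriv (B t) x ^ 2 + W x * B t x ^ 2)) atBot (𝓝 0) ∧
        (∃ (N : ℕ) (α : ℕ → ℝ → ℝ), ∀ z : ℝ × ℝ, 1 + |z.1| < z.2 →
          B z.1 z.2 = ∑ i ∈ Finset.range N, α i z.2 * z.1 ^ i) ∧
        (2 * k ≤ n → ∃ f f' : ℝ → ℝ,
          (∀ x, 1 ≤ x → B 0 x = f x ∧ deriv (fun τ => B τ x) 0 = 0 ∧ deriv (B 0) x = f' x) ∧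
          (∀ x : ℝ, 1 ≤ x → |f x - x ^ (-((n - 2 * k : ℕ) : ℝ))|
              ≤ Kp k * εK * x ^ (-((n - 2 * k : ℕ) : ℝ) - 1 / 2) ∧
            |f' x + ((n - 2 * k : ℕ) : ℝ) * x ^ (-((n - 2 * k : ℕ) : ℝ) - 1)|
              ≤ Kp k * εK * x ^ (-((n - 2 * k : ℕ) : ℝ) - 3 / 2))) := by
      intro k
      by_cases hk : 2 * k ≤ n
      · obtain ⟨B, f, f', h1, h2, h3, h4, h5, h6, hdata, -, -, hcl⟩ :=
          hKp k hW hW0 hεK0.le hεK64 hclose (by simpa using hk)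
        refine ⟨B, h1, h2, h3, h4, h5, h6, fun _ => ⟨f, f', fun x hx => ?_, fun x hx => ?_⟩⟩
        · obtain ⟨e1, e2, e3⟩ := hdata x hx
          refine ⟨by simpa using e1, by simpa using e2, by simpa using e3⟩
        · have em : (2 * k : ℝ) - n = -((n - 2 * k : ℕ) : ℝ) := by
            push_cast [Nat.cast_sub hk]; ring
          obtain ⟨c1, c2⟩ := hcl x (by linarith)
          rw [em] at c1 c2
          refine ⟨c1, ?_⟩
          simpa only [neg_mul, sub_neg_eq_add] using c2
      · exact ⟨fun _ _ => 0, z1, z2, z3, z4, z5, z6, fun h => absurd h hk⟩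
    choose Bp hBpC hBpres hBpint hBpT hBpB hBppoly hBpdata using hPk
    -- velocity elements
    have hVk : ∀ k : ℕ, ∃ B : ℝ → ℝ → ℝ, ContDiff ℝ 2 (Function.uncurry B) ∧
        (∀ t x, 1 ≤ x →
          iteratedDeriv 2 (fun τ => B τ x) t - iteratedDeriv 2 (B t) x + W x * B t x = 0) ∧
        IntegrableOn (fun x => deriv (fun τ => B τ x) 0 ^ 2 + deriv (B 0) x ^ 2
          + W x * B 0 x ^ 2) (Ioi 1) ∧
        Tendsto (fun t => ∫ x in Ioi (1 + |t|), (deriv (fun τ => B τ x) t ^ 2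
          + deriv (B t) x ^ 2 + W x * B t x ^ 2)) atTop (𝓝 0) ∧
        Tendsto (fun t => ∫ x in Ioi (1 + |t|), (deriv (fun τ => B τ x) t ^ 2
          + deriv (B t) x ^ 2 + W x * B t x ^ 2)) atBot (𝓝 0) ∧
        (∃ (N : ℕ) (α : ℕ → ℝ → ℝ), ∀ z : ℝ × ℝ, 1 + |z.1| < z.2 →
          B z.1 z.2 = ∑ i ∈ Finset.range N, α i z.2 * z.1 ^ i) ∧
        (2 * k + 1 ≤ n → ∃ f : ℝ → ℝ,
          (∀ x, 1 ≤ x → B 0 x = 0 ∧ deriv (fun τ => B τ x) 0 = f x ∧ deriv (B 0) x = 0) ∧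
          (∀ x : ℝ, 1 ≤ x → |f x - x ^ (-((n - 2 * k : ℕ) : ℝ))|
              ≤ Kv k * εK * x ^ (-((n - 2 * k : ℕ) : ℝ) - 1 / 2))) := by
      intro k
      by_cases hk : 2 * k + 1 ≤ n
      · obtain ⟨B, f, f', h1, h2, h3, h4, h5, h6, hdata, -, -, hcl⟩ :=
          hKv k hW hW0 hεK0.le hεK64 hclose hk
        refine ⟨B, h1, h2, h3, h4, h5, h6, fun _ => ⟨f, fun x hx => ?_, fun x hx => ?_⟩⟩
        · obtain ⟨e1, e2, e3⟩ := hdata x hx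
          refine ⟨by simpa using e1, by simpa using e2, by simpa using e3⟩
        · have em : (2 * k : ℝ) - n = -((n - 2 * k : ℕ) : ℝ) := by
            push_cast [Nat.cast_sub (by omega : 2 * k ≤ n)]; ring
          obtain ⟨c1, -⟩ := hcl x (by linarith)
          rw [em] at c1
          exact c1
      · exact ⟨fun _ _ => 0, z1, z2, z3, z4, z5, z6, fun h => absurd h hk⟩
    choose Bv hBvC hBvres hBvint hBvT hBvB hBvpoly hBvdata using hVk
    refine hKFP W hW hW0 εK hεK0.le hεK4 hclose Bp Bv hBpC hBvC hBpres hBvres hBpint hBvint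
      hBpT hBpB hBvT hBvB hBppoly hBvpoly (fun k hk => ?_) (fun k hk => ?_)
    · -- position closeness
      have hk' := Finset.mem_range.1 hk
      have hk2 : 2 * k ≤ n := by omega
      have hkn : k ≤ n := by omega
      obtain ⟨f, f', hdata, hf⟩ := hBpdata k hk2
      have hpc := position_closeness hι hιeq hW0 hεK0.le hεK4 hclose (n - 2 * k) (hBpC k)
        (E := Kp k * εK) (mul_nonneg (hKp0 k) hεK0.le) hdata hf
      have href := position_reference_lower hι hιeq hW hW0 hn1 hεK0.le hεK4 hclose (n - 2 * k)
      calc _ ≤ Kp k * εK * ((n : ℝ) + 2) := hpc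
        _ ≤ δ₀ * (1 / 2) := by
            have h1 : Kp k * εK * ((n : ℝ) + 2) ≤ (Kmax + 1) * εK * ((n : ℝ) + 2) := by
              gcongr; linarith [hKpK k hkn]
            nlinarith [h1, hεKδ']
        _ ≤ δ₀ * _ := mul_le_mul_of_nonneg_left href hδ₀.le
    · -- velocity closeness
      have hk' := Finset.mem_range.1 hk
      have hk2 : 2 * k + 1 ≤ n := by omega
      have hkn : k ≤ n := by omega
      have hm1 : 1 ≤ n - 2 * k := by omega
      obtain ⟨f, hdata, hf⟩ := hBvdata k hk2
      have hvc := velocity_closeness hιeq hW0 hm1 (B := Bv k) (E := Kv k * εK)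
        (mul_nonneg (hKv0 k) hεK0.le) hdata hf
      have href := velocity_reference_lower hιeq hm1 (Nat.sub_le n (2 * k))
      calc _ ≤ Kv k * εK := hvc
        _ ≤ δ₀ * (1 / (2 * ((n : ℝ) + 1))) := by
            rw [mul_one_div, le_div_iff₀ (by positivity)]
            have hKv' : Kv k ≤ Kmax + 1 := by linarith [hKvK k hkn]
            have h1a : Kv k * εK ≤ (Kmax + 1) * εK := mul_le_mul_of_nonneg_right hKv' hεK0.le
            have h1 : Kv k * εK * (2 * ((n : ℝ) + 1)) ≤ (Kmax + 1) * εK * (2 * ((n : ℝ) + 2)) :=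
              mul_le_mul h1a (by linarith) (by positivity) (by positivity)
            nlinarith [h1, hεKδ']
        _ ≤ δ₀ * _ := mul_le_mul_of_nonneg_left href hδ₀.le

end Literature.Analysis.PDE
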